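import Summits.QuantumFields.BalabanUV.Beta.EriceRemainderEnclosureHistoryAutonomyComparisonAffineProfile

/-!
# EriceRemainderEnclosureHistoryAutonomyComparisonFading — (E60a) FADING MEMORIES COMPARE AT ANY SIZE: `B(u) = ρ(u_0) + Σ_{k<K} L_k·u_k` with the profile
# NON-INCREASING FROM AGE ONE ON (`L_1 ≥ L_2 ≥ L_3 ≥ …`; the Markov weight `L_0` and the isotone newest-entry term `ρ` ARBITRARY, ALL SIZES ARBITRARY) and
# every `B′ ≥ B` with a zeroth moment and an ISOTONE excess: ANY box solutions from one pin satisfy `h′ ≤ h` at every scale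
# (`le_of_isotone_excess_dom_fading`, `le_of_isotone_excess_affine_fading`; uniform windows `c·Σ_{k<K} u_k` and geometric memories `M·Σ_k θ^k·u_k` as
# corollaries) — by the SHORTEST DUAL CERTIFICATE of the step: the comparison at scale ONE, read through the profile one age later

Cell `pub-balaban`, β-function sub-cell, BINDER row D4 «RemainderConst leaves for Bałaban's split» (`HOME/BINDER-OWNERS.md`; owner lineage `b2b-balaban-beta-an4`;
this file by co-owner #2 lineage `b2b-balaban-beta-d4-p2`, generation 53), β-FLOW TEAM duty (1), FREEZE (0) honoured (def-free; (E58a)'s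
`le_of_isotone_excess_of_step`, (E58b)'s `weight_le_profile` ∕ `profile_pos`, (E49j)'s `excess_shift_le`, (E48a)'s `strictAnti_of_memFlow`, (E41)'s
`affine_monotone` ∕ `affine_floor` ∕ `affine_zerothMoment`, node U2's `MemFlow` ∕ `seqBox_shift` ∕ `Sharpness.abs_sub_le_half_cube_mul` BY NAME; nothing
restated).  Sequel of (E58b) `…ComparisonAffineProfile` (profile condition `Σ_j L_j∕P_j ≤ 2`) and (E59e) `…ComparisonTwoAges` (any two ages); answers the
item «uniform windows as a theorem» left open in `HOME/b2b-balaban-beta-d4-p2/HANDOFF.gen51.md` and types the first of the «dual certificates» of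
`HOME/…/g51/e58/README.md` (heuristic 3 there, so far numerics only).

HONEST FRAMING (page 1, verbatim and binding).  *"Discharging BetaPertH makes Bałaban's UV stability UNCONDITIONAL — a real constructive-QFT result; it is
NOT the continuum limit and NOT the Clay problem."*  THIS FILE DISCHARGES NOTHING OF THE KIND.  Elementary real analysis about ABSTRACT functionals on a box
]0,γ]^ℕ with displayed signs, domination and moduli — hypotheses of a census, not facts; the form, signs and moments of Bałaban's (1.22) limit functional
(in particular its age profile, fading or not) are NOT PRINTED ([I] p. 298; GAPS G-t4-U2-1∕-2) and NOT asserted.  Row D4 class UNCHANGED (critical-path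
width 0; instance 0∕1; D4 DISCHARGE NO DATE).  HONEST DEPENDENCY: continuum YM on T⁴ ⇐ BetaPertH ∧ nine spine estimates (0/9 proved); BetaPertH ⇐ (D1) ∧
(D4) ∧ CAP+tail; G-an2-4 gates asym, D1 and NE2/3/4.

THE POINT (census sense (α); the COMPARISON column of the autonomy row).  By (E58a) comparison at any size is THE STEP: for box solutions `h`, `h′` of `B`,
`B′` from one pin with `h′ ≤ h`, the drop `d₀ = B h − B h′` is at most the excess `η = (B′ − B)(h′)`.  Write `g_k = h_k − h′_k ≥ 0` (`g_0 = 0`), `δ₁ =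
1∕h′_1² − 1∕h_1² ≥ 0` for the level gap at scale one, `d₁ = B(h(1+·)) − B(h′(1+·))` for the drop read one scale deeper and `η₀ = (B′ − B)(h′(1+·)) ≤ η` for the
excess read there (isotone excess, decreasing trajectory).  The flow equations at scale `0 → 1` give EXACTLY `δ₁ = η₀ − d₁` — comparison at scale one IS
`d₁ ≤ η₀`; what the step asks is the same inequality ONE LATTICE STEP TOWARDS THE INFRARED, `d₀ ≤ η`, and in the continuum limit the two coincide (the step is
the sign of a one-sided derivative, `g51/e58/README.md` heuristic 2).  For the class `B(u) = ρ(u_0) + Σ_k L_k·u_k` (in inequality form: the profile dominates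
the DIFFERENCES of `B`, `Σ_k L_k(u_k − u′_k) ≤ B u − B u′` for `u′ ≤ u` — NEW hypothesis shape `hlow` of this file, implying isotonicity and, with the floor,
domination — and `B u − B u′ ≤ Σ_k L_k(u_k − u′_k)` at fixed newest entry, (E58b)'s `hdrop`) the lattice defect is a SUMMATION BY PARTS IN THE AGE:
`d₀ ≤ Σ_{k≥1} L_k g_k = L_1 g_1 + Σ_{k≥2} L_k g_k ≤ L_1 g_1 + Σ_{k≥2} L_{k−1} g_k ≤ L_1 g_1 + Σ_{k≥0} L_k g_{k+1} ≤ L_1·(h_1³∕2)·δ₁ + d₁` as soon as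
**`L_{k} ≤ L_{k−1}` for `k ≥ 2`** (§1 `sum_le_of_fading`), and `L_1·h_1³ ≤ √2 < 2` holds along EVERY trajectory of the class WHATEVER the sizes ((E58b)
`weight_le_profile` at age one: `L_1·h_1³·P_1 ≤ L_1`, `P_1 ≥ L_1∕√2`); hence `d₀ ≤ δ₁ + d₁ = η₀ ≤ η`.  In the language of `g51/e58/README.md` this is the
dual certificate `φ = 𝟙_{0}` (conditions `L_1w_1 ≤ 1 + L_0w_1`, `L_j ≤ L_{j−1}` for `j ≥ 2`), the level-weight certificate of (E58b) being `φ_n = Σ_{j>n}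
L_jw_j`.  CONSEQUENCE: EVERY FADING MEMORY — profile non-increasing in the age from age one on, Markov weight and newest-entry term free — COMPARES AT ANY
SIZE under isotone excesses: uniform windows `c·Σ_{k<K} u_k` and `c·Σ_{1≤k<K} u_k` of ANY length and strength (gen 51 measured their profile sums `↑ ≈ 1.65`
and left the finite square-root sums untyped — not needed), geometric memories `M·Σ_k θ^k u_k` (`0 ≤ θ ≤ 1`, the shape node U2's `FadingMemory` posits for
the modulus), power laws.  NOT CLAIMED: profiles that RISE somewhere after age one (windows `[K₀, K₁]` with `K₀ ≥ 2` stay with (E58b)∕(E58c)∕(E59e));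
the general conjecture (E58′); necessity; anything printed.

WHAT IS PROVED ([folklore]; 0 `def`, 0 sorry).  §1 `sum_le_of_fading_aux`, **`sum_le_of_fading`** (summation by parts against a fading profile),
`mono_of_low`, `dom_of_low` (the class is isotone and dominated), `weight_one_le_one` (`L_1·h_1³∕2 ≤ 1` along every trajectory).  §2
**`effective_le_of_family_le_at_fading`** (THE STEP).  §3 ENDs **`le_of_isotone_excess_dom_fading`**, **`le_of_isotone_excess_affine_fading`**,
`le_of_isotone_excess_affine_uniform`, `le_of_isotone_excess_affine_geometric`.
-/
noncomputable section
open Finset Set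

namespace Summit.QuantumFields.BalabanUV.Beta.EriceRemainderEnclosureHistoryAutonomyComparisonFading

open Literature.MathematicalPhysics.QuantumFieldTheory.Balaban1983to89
open Literature.MathematicalPhysics.QuantumFieldTheory.Balaban1983to89.T4BetaStationary
open Literature.MathematicalPhysics.QuantumFieldTheory.Balaban1983to89.T4BetaFlowWellPosed
open Literature.MathematicalPhysics.QuantumFieldTheory.Balaban1983to89.T4BetaFlowWellPosed.Sharpness (abs_sub_le_half_cube_mul)
open Summit.QuantumFields.BalabanUV.Beta.EriceRemainderEnclosureHistoryAutonomyOrder (strictAnti_of_memFlow)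
open Summit.QuantumFields.BalabanUV.Beta.EriceRemainderEnclosureHistoryAutonomyComparisonExcess (excess_shift_le)
open Summit.QuantumFields.BalabanUV.Beta.EriceRemainderEnclosureHistoryAutonomyComparisonPrinciple (le_of_isotone_excess_of_step)
open Summit.QuantumFields.BalabanUV.Beta.EriceRemainderEnclosureHistoryAutonomyComparisonAffineProfile (profile_pos weight_le_profile)
open Summit.QuantumFields.BalabanUV.Beta.EriceRemainderEnclosureHistoryAutonomyMonotone (affine_monotone affine_floor affine_zerothMoment)

variable {B B' : (ℕ → ℝ) → ℝ} {M M' γ b y : ℝ} {L : ℕ → ℝ} {K : ℕ} {h h' : ℕ → ℝ}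

/-! ## §1 Summation by parts against a fading profile; the class is isotone and dominated; the weight of age one -/

/-- Summation by parts against a profile `L ≥ 0` NON-INCREASING FROM AGE ONE ON, auxiliary form: for `g ≥ 0` with `g 0 = 0`,
`Σ_{k<n+2} L_k·g_k ≤ L_1·g_1 + Σ_{k<n+1} L_k·g_{k+1}` (each `L_k·g_k`, `k ≥ 2`, is at most `L_{k−1}·g_k`). [folklore] -/
theorem sum_le_of_fading_aux {g : ℕ → ℝ} (hL : ∀ k, 0 ≤ L k) (hfade : ∀ k, 1 ≤ k → L (k + 1) ≤ L k) (hg : ∀ k, 0 ≤ g k)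
    (hg0 : g 0 = 0) (n : ℕ) :
    ∑ k ∈ range (n + 2), L k * g k ≤ L 1 * g 1 + ∑ k ∈ range (n + 1), L k * g (k + 1) := by
  induction n with
  | zero =>
    have h01 : 0 ≤ L 0 * g 1 := mul_nonneg (hL 0) (hg 1)
    rw [sum_range_succ, sum_range_succ, sum_range_zero, sum_range_succ, sum_range_zero, hg0]
    simp only [zero_add, mul_zero]
    linarith
  | succ n ih =>
    have hstep : L (n + 2) * g (n + 2) ≤ L (n + 1) * g (n + 1 + 1) :=
      mul_le_mul_of_nonneg_right (hfade (n + 1) (by omega)) (hg _)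
    rw [show n + 1 + 2 = n + 2 + 1 from rfl, sum_range_succ, sum_range_succ (fun k => L k * g (k + 1)) (n + 1)]
    linarith

/-- **SUMMATION BY PARTS AGAINST A FADING PROFILE**: `L ≥ 0` with `L_{k+1} ≤ L_k` for `k ≥ 1` (the Markov weight `L_0` is free), `g ≥ 0` with `g_0 = 0`;
then for every range `K`: `Σ_{k<K} L_k·g_k ≤ L_1·g_1 + Σ_{k<K} L_k·g_{k+1}` — the profile read of `g` is at most the weight of age one on `g_1` plus the
profile read of `g` ONE AGE LATER. [folklore] -/
theorem sum_le_of_fading {g : ℕ → ℝ} (hL : ∀ k, 0 ≤ L k) (hfade : ∀ k, 1 ≤ k → L (k + 1) ≤ L k) (hg : ∀ k, 0 ≤ g k)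
    (hg0 : g 0 = 0) (K : ℕ) :
    ∑ k ∈ range K, L k * g k ≤ L 1 * g 1 + ∑ k ∈ range K, L k * g (k + 1) := by
  have h11 : 0 ≤ L 1 * g 1 := mul_nonneg (hL 1) (hg 1)
  rcases Nat.lt_or_ge K 2 with hK | hK
  · interval_cases K
    · simp only [sum_range_zero]; linarith
    · have h01 : 0 ≤ L 0 * g (0 + 1) := mul_nonneg (hL 0) (hg _)
      rw [sum_range_one, sum_range_one, hg0, mul_zero]
      linarith
  · obtain ⟨n, rfl⟩ := Nat.exists_eq_add_of_le' hK
    have hlast : 0 ≤ L (n + 1) * g (n + 1 + 1) := mul_nonneg (hL _) (hg _)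
    have hmono : ∑ k ∈ range (n + 1), L k * g (k + 1) ≤ ∑ k ∈ range (n + 2), L k * g (k + 1) := by
      rw [sum_range_succ (fun k => L k * g (k + 1)) (n + 1)]
      linarith
    exact (sum_le_of_fading_aux hL hfade hg hg0 n).trans (by linarith)

/-- A memory whose DIFFERENCES dominate the profile's (`Σ_{k<K} L_k·(u_k − u′_k) ≤ B u − B u′` for `u′ ≤ u` on the box, `L ≥ 0`) is ISOTONE. [folklore] -/
theorem mono_of_low (hL : ∀ k, 0 ≤ L k)
    (hlow : ∀ u u' : ℕ → ℝ, SeqBox γ u → SeqBox γ u' → (∀ j, u' j ≤ u j) → ∑ k ∈ range K, L k * (u k - u' k) ≤ B u - B u') :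
    ∀ u v : ℕ → ℝ, SeqBox γ u → SeqBox γ v → (∀ j, u j ≤ v j) → B u ≤ B v := by
  intro u v hu hv huv
  have h1 := hlow v u hv hu huv
  have h2 : 0 ≤ ∑ k ∈ range K, L k * (v k - u k) := sum_nonneg fun k _ => mul_nonneg (hL k) (sub_nonneg.mpr (huv k))
  linarith

/-- … and, given a floor `b > 0`, DOMINATED by the profile: `Σ_{k<K} L_k·u_k ≤ B u` on the box (compare `u` with `min(u, c)` for the constant
`c = b∕(Σ_k L_k + 1)`, whose profile read is at most `b ≤ B(min(u,c))`). [folklore] -/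
theorem dom_of_low (hL : ∀ k, 0 ≤ L k) (hb : 0 < b) (hlo : ∀ u, SeqBox γ u → b ≤ B u)
    (hlow : ∀ u u' : ℕ → ℝ, SeqBox γ u → SeqBox γ u' → (∀ j, u' j ≤ u j) → ∑ k ∈ range K, L k * (u k - u' k) ≤ B u - B u') :
    ∀ u : ℕ → ℝ, SeqBox γ u → ∑ k ∈ range K, L k * u k ≤ B u := by
  intro u hu
  have hS : 0 ≤ ∑ k ∈ range K, L k := sum_nonneg fun k _ => hL k
  set c : ℝ := b / (∑ k ∈ range K, L k + 1) with hc_def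
  have hc0 : 0 < c := div_pos hb (by linarith)
  set u' : ℕ → ℝ := fun k => min (u k) c with hu'_def
  have hu' : SeqBox γ u' := fun k => ⟨lt_min (hu k).1 hc0, (min_le_left _ _).trans (hu k).2⟩
  have hle : ∀ j, u' j ≤ u j := fun j => min_le_left _ _
  have h1 := hlow u u' hu hu' hle
  have h2 : b ≤ B u' := hlo u' hu'
  have h3 : ∑ k ∈ range K, L k * u' k ≤ b := by
    have hSc : (∑ k ∈ range K, L k) * c ≤ b := by
      rw [hc_def, ← mul_div_assoc, div_le_iff₀ (by linarith)]
      nlinarith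
    calc ∑ k ∈ range K, L k * u' k ≤ ∑ k ∈ range K, L k * c :=
          sum_le_sum fun k _ => mul_le_mul_of_nonneg_left (min_le_right _ _) (hL k)
      _ = (∑ k ∈ range K, L k) * c := by rw [sum_mul]
      _ ≤ b := hSc
  have h4 : ∑ k ∈ range K, L k * (u k - u' k) = ∑ k ∈ range K, L k * u k - ∑ k ∈ range K, L k * u' k := by
    rw [← sum_sub_distrib]
    exact sum_congr rfl fun k _ => by ring
  linarith

/-- **THE WEIGHT OF AGE ONE IS AT MOST ONE**: `L_1·(h_1³∕2) ≤ 1` along EVERY box solution from EVERY pin of a memory of the class (isotone, floor `b > 0`,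
dominated by the profile `L ≥ 0`), WHATEVER the sizes — (E58b) `weight_le_profile` at age one (`L_1·h_1³·P_1 ≤ L_1`, `P_1 = Σ_k L_k·√(1∕(1+k)) ≥ L_1∕√2 ≥
L_1∕2`).  Vacuous ranges (`K ≤ 1`) and `L_1 = 0` included. [folklore] -/
theorem weight_one_le_one (hmono : ∀ u v : ℕ → ℝ, SeqBox γ u → SeqBox γ v → (∀ j, u j ≤ v j) → B u ≤ B v) (hL : ∀ k, 0 ≤ L k)
    (hb : 0 < b) (hlo : ∀ u, SeqBox γ u → b ≤ B u) (hdom : ∀ u, SeqBox γ u → ∑ k ∈ range K, L k * u k ≤ B u) (hy : 0 < y)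
    (hh : SeqBox γ h) (hf : MemFlow B y h) (hK : 1 ∈ range K) : L 1 * (h 1 ^ 3 / 2) ≤ 1 := by
  have h1 := (hh 1).1
  rcases (hL 1).eq_or_lt with hL1 | hL1
  · rw [← hL1]; simp
  have hP := profile_pos hL hK le_rfl hL1
  set P : ℝ := ∑ k ∈ range K, L k * Real.sqrt (((1 : ℕ) : ℝ) / (((1 : ℕ) : ℝ) + k)) with hP_def
  have hw := weight_le_profile hmono hL hb hlo hdom hy hh hf hK
  -- h 1 ^ 3 * P ≤ 1
  have h3 : h 1 ^ 3 * P ≤ 1 := by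
    have e : L 1 * ((1 : ℕ) : ℝ) * h 1 ^ 3 = L 1 * h 1 ^ 3 := by simp
    rw [e, le_div_iff₀ hP] at hw
    have : L 1 * (h 1 ^ 3 * P) ≤ L 1 * 1 := by rw [mul_one]; calc L 1 * (h 1 ^ 3 * P) = L 1 * h 1 ^ 3 * P := by ring
      _ ≤ L 1 := hw
    exact le_of_mul_le_mul_left this hL1
  -- P ≥ L 1 · √(1/2) ≥ L 1 / 2
  have hs : (1 : ℝ) / 2 ≤ Real.sqrt (((1 : ℕ) : ℝ) / (((1 : ℕ) : ℝ) + ((1 : ℕ) : ℝ))) := by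
    have e : (((1 : ℕ) : ℝ) / (((1 : ℕ) : ℝ) + ((1 : ℕ) : ℝ))) = 1 / 2 := by norm_num
    rw [e]
    have hsq := Real.sq_sqrt (show (0 : ℝ) ≤ 1 / 2 by norm_num)
    nlinarith [Real.sqrt_nonneg ((1 : ℝ) / 2)]
  have hPge : L 1 * (1 / 2) ≤ P := by
    have hsingle : L 1 * Real.sqrt (((1 : ℕ) : ℝ) / (((1 : ℕ) : ℝ) + ((1 : ℕ) : ℝ))) ≤ P := by
      rw [hP_def]
      exact single_le_sum (f := fun k => L k * Real.sqrt (((1 : ℕ) : ℝ) / (((1 : ℕ) : ℝ) + k)))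
        (fun k _ => mul_nonneg (hL k) (Real.sqrt_nonneg _)) hK
    exact (mul_le_mul_of_nonneg_left hs hL1.le).trans hsingle
  have h13 : 0 ≤ h 1 ^ 3 := by positivity
  calc L 1 * (h 1 ^ 3 / 2) = h 1 ^ 3 * (L 1 * (1 / 2)) := by ring
    _ ≤ h 1 ^ 3 * P := mul_le_mul_of_nonneg_left hPge h13
    _ ≤ 1 := h3

/-! ## §2 THE STEP for fading profiles -/

/-- **THE STEP FOR FADING MEMORIES.**  `B` with floor `b > 0` on ]0,γ], whose differences DOMINATE those of the profile `L ≥ 0` (`Σ_{k<K} L_k·(u_k − u′_k) ≤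
B u − B u′` for `u′ ≤ u`) and ARE DOMINATED by them at fixed newest entry (`B u − B u′ ≤ Σ_k L_k·(u_k − u′_k)` for `u′ ≤ u`, `u′_0 = u_0`) — i.e. `B(u) =
ρ(u_0) + Σ_k L_k·u_k` with `ρ` non-decreasing — the profile FADING from age one on (`L_{k+1} ≤ L_k` for `k ≥ 1`; `L_0`, `L_1` and all sizes ARBITRARY);
`B ≤ B′` on the box with ISOTONE excess; `h`, `h′` box solutions of `B`, `B′` from one pin `y` with `h′ ≤ h` at every scale.  Then `B h ≤ B′ h′`:
`B h − B h′ ≤ L_1·g_1 + Σ_k L_k·g_{k+1} ≤ L_1·(h_1³∕2)·δ₁ + d₁ ≤ δ₁ + d₁ = η₀ ≤ η` (summation by parts in the age, the weight of age one, and the flow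
equations at scale `0 → 1`). [folklore] -/
theorem effective_le_of_family_le_at_fading (hL : ∀ k, 0 ≤ L k) (hb : 0 < b) (hlo : ∀ u, SeqBox γ u → b ≤ B u)
    (hdrop : ∀ u u' : ℕ → ℝ, SeqBox γ u → SeqBox γ u' → (∀ j, u' j ≤ u j) → u' 0 = u 0 → B u - B u' ≤ ∑ k ∈ range K, L k * (u k - u' k))
    (hlow : ∀ u u' : ℕ → ℝ, SeqBox γ u → SeqBox γ u' → (∀ j, u' j ≤ u j) → ∑ k ∈ range K, L k * (u k - u' k) ≤ B u - B u')
    (hfade : ∀ k, 1 ≤ k → L (k + 1) ≤ L k)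
    (hexc : ∀ u, SeqBox γ u → B u ≤ B' u)
    (hDmono : ∀ u v : ℕ → ℝ, SeqBox γ u → SeqBox γ v → (∀ j, u j ≤ v j) → B' u - B u ≤ B' v - B v)
    (hy : 0 < y) (hh : SeqBox γ h) (hf : MemFlow B y h) (hh' : SeqBox γ h') (hf' : MemFlow B' y h') (hle : ∀ j, h' j ≤ h j) :
    B h ≤ B' h' := by
  have hmono := mono_of_low hL hlow
  have hdom := dom_of_low hL hb hlo hlow
  have hlo' : ∀ u, SeqBox γ u → b ≤ B' u := fun u hu => (hlo u hu).trans (hexc u hu)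
  have hanti' : Antitone h' := (strictAnti_of_memFlow hb hlo' hh' hf').antitone
  set η : ℝ := B' h' - B h' with hη_def
  -- the excess read one scale deeper: η₀ ≤ η
  set η₀ : ℝ := B' (fun j => h' (1 + j)) - B (fun j => h' (1 + j)) with hη₀_def
  have hη₀ : η₀ ≤ η := by
    have := (abs_le.mp (excess_shift_le hexc hDmono hh' hanti' 0)).1
    simp only [zero_add] at this
    rw [hη₀_def]; linarith
  -- the drop read one scale deeper: d₁, dominated from below by the profile read of g one age later
  set d₁ : ℝ := B (fun j => h (1 + j)) - B (fun j => h' (1 + j)) with hd₁_def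
  have hd₁ : ∑ k ∈ range K, L k * (h (k + 1) - h' (k + 1)) ≤ d₁ := by
    have := hlow (fun j => h (1 + j)) (fun j => h' (1 + j)) (seqBox_shift hh 1) (seqBox_shift hh' 1) fun j => hle (1 + j)
    rw [hd₁_def]
    refine le_trans (le_of_eq (sum_congr rfl fun k _ => ?_)) this
    rw [add_comm k 1]
  -- the level gap at scale one: δ₁ = η₀ − d₁ ≥ 0
  set δ₁ : ℝ := 1 / h' 1 ^ 2 - 1 / h 1 ^ 2 with hδ₁_def
  have hδ₁ : δ₁ = η₀ - d₁ := by
    have e := hf.2 0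
    have e' := hf'.2 0
    simp only [zero_add] at e e'
    rw [hf.1] at e
    rw [hf'.1] at e'
    rw [hδ₁_def, hη₀_def, hd₁_def, e, e']
    ring
  have hδ₁0 : 0 ≤ δ₁ :=
    sub_nonneg.mpr (one_div_le_one_div_of_le (pow_pos (hh' 1).1 2) (pow_le_pow_left₀ (hh' 1).1.le (hle 1) 2))
  -- the gap at scale one: g₁ ≤ (h_1³/2)·δ₁
  have hg₁ : h 1 - h' 1 ≤ h 1 ^ 3 / 2 * δ₁ := by
    have hw := abs_sub_le_half_cube_mul (hh 1).1 (hh' 1).1 le_rfl (hle 1)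
    rw [abs_sub_comm (1 / h 1 ^ 2), ← hδ₁_def, abs_of_nonneg hδ₁0] at hw
    exact (le_abs_self _).trans hw
  -- the drop at the pin, summed by parts against the fading profile
  have h0 : h' 0 = h 0 := by rw [hf.1, hf'.1]
  have hg : ∀ k, 0 ≤ h k - h' k := fun k => sub_nonneg.mpr (hle k)
  have hg0 : h 0 - h' 0 = 0 := by rw [h0, sub_self]
  have hparts := sum_le_of_fading (g := fun k => h k - h' k) hL hfade hg hg0 K
  have hdrop' : B h - B h' ≤ L 1 * (h 1 - h' 1) + d₁ :=
    (hdrop h h' hh hh' hle h0).trans (hparts.trans (by linarith))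
  -- the weight of age one (vacuous when K ≤ 1: then the drop at the pin vanishes outright)
  rcases Nat.lt_or_ge K 2 with hK | hK
  · have hzero : B h - B h' ≤ 0 := by
      refine (hdrop h h' hh hh' hle h0).trans ?_
      interval_cases K
      · simp
      · rw [sum_range_one, hg0, mul_zero]
    have : 0 ≤ η := by rw [hη_def]; linarith [hexc h' hh']
    linarith
  have hw1 : L 1 * (h 1 ^ 3 / 2) ≤ 1 := weight_one_le_one hmono hL hb hlo hdom hy hh hf (mem_range.mpr (by omega))
  have hkey : L 1 * (h 1 - h' 1) ≤ δ₁ := by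
    calc L 1 * (h 1 - h' 1) ≤ L 1 * (h 1 ^ 3 / 2 * δ₁) := mul_le_mul_of_nonneg_left hg₁ (hL 1)
      _ = L 1 * (h 1 ^ 3 / 2) * δ₁ := by ring
      _ ≤ 1 * δ₁ := mul_le_mul_of_nonneg_right hw1 hδ₁0
      _ = δ₁ := one_mul _
  have : B h - B h' ≤ η := by linarith
  rw [hη_def] at this
  linarith

/-! ## §3 ENDs: fading memories compare at any size -/

/-- **FADING MEMORIES COMPARE AT ANY SIZE.**  `B` on ]0,γ] with floor `b > 0` and zeroth moment `M ≥ 0` (ANY size), of the class `ρ(u_0) + Σ_{k<K} L_k·u_k`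
in inequality form (`Σ_k L_k·(u_k − u′_k) ≤ B u − B u′` for `u′ ≤ u`; `B u − B u′ ≤ Σ_k L_k·(u_k − u′_k)` for `u′ ≤ u` with `u′_0 = u_0`; `L ≥ 0`), the
profile FADING from age one on: **`L_{k+1} ≤ L_k` for every `k ≥ 1`** (`L_0`, `L_1` and ALL SIZES ARBITRARY); `B′` with zeroth moment `M′ ≥ 0`, `B ≤ B′` on
the box, the EXCESS `B′ − B` ISOTONE; `h`, `h′` ANY box solutions of `B`, `B′` from one pin `p ∈ ]0,γ]`.  Then `h′ ≤ h` at EVERY scale — (E58a)'s principle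
with §2's step. [folklore] -/
theorem le_of_isotone_excess_dom_fading {p : ℝ}
    (hB : ∀ u u' : ℕ → ℝ, SeqBox γ u → SeqBox γ u' → ∀ D : ℝ, (∀ j, |u j - u' j| ≤ D) → |B u - B u'| ≤ M * D) (hM : 0 ≤ M)
    (hL : ∀ k, 0 ≤ L k) (hb : 0 < b) (hlo : ∀ u, SeqBox γ u → b ≤ B u)
    (hdrop : ∀ u u' : ℕ → ℝ, SeqBox γ u → SeqBox γ u' → (∀ j, u' j ≤ u j) → u' 0 = u 0 → B u - B u' ≤ ∑ k ∈ range K, L k * (u k - u' k))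
    (hlow : ∀ u u' : ℕ → ℝ, SeqBox γ u → SeqBox γ u' → (∀ j, u' j ≤ u j) → ∑ k ∈ range K, L k * (u k - u' k) ≤ B u - B u')
    (hfade : ∀ k, 1 ≤ k → L (k + 1) ≤ L k)
    (hB' : ∀ u u' : ℕ → ℝ, SeqBox γ u → SeqBox γ u' → ∀ D : ℝ, (∀ j, |u j - u' j| ≤ D) → |B' u - B' u'| ≤ M' * D) (hM' : 0 ≤ M')
    (hexc : ∀ u, SeqBox γ u → B u ≤ B' u)
    (hDmono : ∀ u v : ℕ → ℝ, SeqBox γ u → SeqBox γ v → (∀ j, u j ≤ v j) → B' u - B u ≤ B' v - B v)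
    (hp : 0 < p) (hpγ : p ≤ γ) (hh : SeqBox γ h) (hf : MemFlow B p h) (hh' : SeqBox γ h') (hf' : MemFlow B' p h') (j : ℕ) :
    h' j ≤ h j :=
  le_of_isotone_excess_of_step (mono_of_low hL hlow) hB hM hb hlo hB' hM' hexc hDmono
    (fun _ hy _ _ _ hu hfu hu' hfu' hle =>
      effective_le_of_family_le_at_fading hL hb hlo hdrop hlow hfade hexc hDmono hy hu hfu hu' hfu' hle)
    hp hpγ hh hf hh' hf' j

/-- **THE FADING AFFINE MEMORY `B(u) = b + Σ_{k<K} L_k·u_k` COMPARES AT ANY SIZE** (`b > 0`, `L ≥ 0` with `L_{k+1} ≤ L_k` for `k ≥ 1` — the Markov weight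
`L_0`, the strength `L_1`, the range `K` and all sizes ARBITRARY): for every `B′ ≥ B` with a zeroth moment and an ISOTONE excess, ANY box solutions from one
pin satisfy `h′ ≤ h` at every scale. [folklore] -/
theorem le_of_isotone_excess_affine_fading {p : ℝ} (hL : ∀ k, 0 ≤ L k) (hb : 0 < b) (hfade : ∀ k, 1 ≤ k → L (k + 1) ≤ L k)
    (hB' : ∀ u u' : ℕ → ℝ, SeqBox γ u → SeqBox γ u' → ∀ D : ℝ, (∀ j, |u j - u' j| ≤ D) → |B' u - B' u'| ≤ M' * D) (hM' : 0 ≤ M')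
    (hexc : ∀ u, SeqBox γ u → (fun u : ℕ → ℝ => b + ∑ k ∈ range K, L k * u k) u ≤ B' u)
    (hDmono : ∀ u v : ℕ → ℝ, SeqBox γ u → SeqBox γ v → (∀ j, u j ≤ v j) →
      B' u - (fun u : ℕ → ℝ => b + ∑ k ∈ range K, L k * u k) u ≤ B' v - (fun u : ℕ → ℝ => b + ∑ k ∈ range K, L k * u k) v)
    (hp : 0 < p) (hpγ : p ≤ γ) (hh : SeqBox γ h) (hf : MemFlow (fun u : ℕ → ℝ => b + ∑ k ∈ range K, L k * u k) p h)
    (hh' : SeqBox γ h') (hf' : MemFlow B' p h') (j : ℕ) : h' j ≤ h j := by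
  refine le_of_isotone_excess_dom_fading (B := fun u : ℕ → ℝ => b + ∑ k ∈ range K, L k * u k) (K := K)
    (affine_zerothMoment hL) (sum_nonneg fun k _ => hL k) hL hb (affine_floor hL) ?_ ?_ hfade hB' hM' hexc hDmono hp hpγ hh hf hh' hf' j
  · intro u u' _ _ _ _
    rw [add_sub_add_left_eq_sub, ← sum_sub_distrib]
    exact le_of_eq (sum_congr rfl fun k _ => by ring)
  · intro u u' _ _ _
    rw [add_sub_add_left_eq_sub, ← sum_sub_distrib]
    exact le_of_eq (sum_congr rfl fun k _ => by ring)

/-- **UNIFORM WINDOWS OF ANY LENGTH AND STRENGTH COMPARE AT ANY SIZE**: `B(u) = b + c·Σ_{k<K} u_k` (`b > 0`, `c ≥ 0`, `K` arbitrary) — the class gen 51 left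
with the untyped estimate `Σ_j L_j∕P_j ↑ ≈ 1.65` (`g51/e58/README.md`); here no profile sum is needed. [folklore] -/
theorem le_of_isotone_excess_affine_uniform {p c : ℝ} (hc : 0 ≤ c) (hb : 0 < b)
    (hB' : ∀ u u' : ℕ → ℝ, SeqBox γ u → SeqBox γ u' → ∀ D : ℝ, (∀ j, |u j - u' j| ≤ D) → |B' u - B' u'| ≤ M' * D) (hM' : 0 ≤ M')
    (hexc : ∀ u, SeqBox γ u → (fun u : ℕ → ℝ => b + ∑ k ∈ range K, c * u k) u ≤ B' u)
    (hDmono : ∀ u v : ℕ → ℝ, SeqBox γ u → SeqBox γ v → (∀ j, u j ≤ v j) →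
      B' u - (fun u : ℕ → ℝ => b + ∑ k ∈ range K, c * u k) u ≤ B' v - (fun u : ℕ → ℝ => b + ∑ k ∈ range K, c * u k) v)
    (hp : 0 < p) (hpγ : p ≤ γ) (hh : SeqBox γ h) (hf : MemFlow (fun u : ℕ → ℝ => b + ∑ k ∈ range K, c * u k) p h)
    (hh' : SeqBox γ h') (hf' : MemFlow B' p h') (j : ℕ) : h' j ≤ h j :=
  le_of_isotone_excess_affine_fading (L := fun _ => c) (fun _ => hc) hb (fun _ _ => le_rfl) hB' hM' hexc hDmono hp hpγ hh hf hh' hf' j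

/-- **GEOMETRIC MEMORIES OF ANY STRENGTH AND RATE COMPARE AT ANY SIZE**: `B(u) = b + c·Σ_{k<K} θ^k·u_k` (`b > 0`, `c ≥ 0`, `0 ≤ θ ≤ 1`, `K` arbitrary) —
the profile shape node U2's `FadingMemory` posits for the history modulus. [folklore] -/
theorem le_of_isotone_excess_affine_geometric {p c θ : ℝ} (hc : 0 ≤ c) (hθ0 : 0 ≤ θ) (hθ1 : θ ≤ 1) (hb : 0 < b)
    (hB' : ∀ u u' : ℕ → ℝ, SeqBox γ u → SeqBox γ u' → ∀ D : ℝ, (∀ j, |u j - u' j| ≤ D) → |B' u - B' u'| ≤ M' * D) (hM' : 0 ≤ M')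
    (hexc : ∀ u, SeqBox γ u → (fun u : ℕ → ℝ => b + ∑ k ∈ range K, c * θ ^ k * u k) u ≤ B' u)
    (hDmono : ∀ u v : ℕ → ℝ, SeqBox γ u → SeqBox γ v → (∀ j, u j ≤ v j) →
      B' u - (fun u : ℕ → ℝ => b + ∑ k ∈ range K, c * θ ^ k * u k) u ≤
        B' v - (fun u : ℕ → ℝ => b + ∑ k ∈ range K, c * θ ^ k * u k) v)
    (hp : 0 < p) (hpγ : p ≤ γ) (hh : SeqBox γ h) (hf : MemFlow (fun u : ℕ → ℝ => b + ∑ k ∈ range K, c * θ ^ k * u k) p h)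
    (hh' : SeqBox γ h') (hf' : MemFlow B' p h') (j : ℕ) : h' j ≤ h j :=
  le_of_isotone_excess_affine_fading (L := fun k => c * θ ^ k) (fun k => mul_nonneg hc (pow_nonneg hθ0 k)) hb
    (fun k _ => by rw [pow_succ]; exact mul_le_mul_of_nonneg_left (mul_le_of_le_one_right (pow_nonneg hθ0 k) hθ1) hc |>.trans_eq (by ring))
    hB' hM' hexc hDmono hp hpγ hh hf hh' hf' j

end Summit.QuantumFields.BalabanUV.Beta.EriceRemainderEnclosureHistoryAutonomyComparisonFading

end
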